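import Mathlib
import Summits.Ventures.HodgeRepro2.T7SupportTwoTorusInvariant
import Summits.Ventures.HodgeRepro2.Tier7.Line3.KappaCongruence

/-!
# Tier 7 — LINE 3 support: the finite-place fields from the LOCAL torus-translate condition at a SPLIT place
(`Line3/KappaDataFinLocalSplit.lean`; t7-L1-p5, gen 3; the split-place twin of `KappaDataFinLocal` p685687 =
option (i) of t7-crit-2's OBJECTION (G), STATUS l. 15466, at the places of `K` that SPLIT in `E`)

`KappaDataFinLocal` derives `KappaData`'s finite fields (x1's `FinKappa` clauses `hout / hS / hcong` on
`|κF γ − κF γ₀|_w`) from the ADELIC support condition read in the completion `E_w` at a place `w` of `K` that is inert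
or ramified in `E` — where `E ⊗ K_w = E_w` is a field with involution and p1's model applies over it. At a place `w`
SPLIT in `E / K` the local algebra is `E ⊗ K_w ≅ K_w × K_w` with the SWAP involution, not a field; x1's `LocalFin`
therefore DISPLAYS the κ-level clauses at the split places (`hS_split` / `hout_split`). This file supplies them from
the local condition itself, in the two components:
* two conjugate embeddings `ψ₁ ψ₂ : E →+* K_w` with `ψ₂ = ψ₁ ∘ σ` (the two factors of `E ⊗ K_w`), ONE absolute value
  `abv` of `K_w` above `w` (`hw : w x = abv (ψ₁ (algebraMap K E x))`);
* the invariant in the two components: `discSplit d₁ f₁ f₂ j = ∑ i, d₁ i · f₁ j i · f₂ j i` and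
  `kappaSplit d₁ d₂ f₁ f₂ g₁ g₂ = c₁ c₂ / (d₁₀ · d′₀)`, `c_i = cc d_i f_i g_i 0 0` — the norm `N(c) = c σ(c)` becomes
  the product of the two components; `map_kappa_eq_kappaSplit`: `ψ₁ (κ(γ)) = kappaSplit` of the components of the
  adapted data and of `γ` (the global invariant read at the split place);
* the local torus translate `IsTranslateSplit f₁ f₂ g₁ g₂ m₁ m₂`: `m_i = diagonal a_i · g_i · t_i` with
  `a₁ 0 · a₂ 0 = 1 = b₁ 0 · b₂ 0` and `ActsOn f_i t_i b_i` — «`t_A⁻¹ g t_B`» in the adapted coordinates of the two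
  components, the norm-one condition `N(a) = (a₁ a₂, a₁ a₂) = 1` of the split torus (as in `KappaDataFinLocal`, only
  the index-`0` norms are required: the clause is WEAKER than torus membership, so the field forms are stronger);
  κ is invariant under it (`kappaSplit_eq_of_isTranslateSplit`: p1's `cc_diag_mul` componentwise);
* x1's bounds in the two components (`abv_kappaSplit_le`, `abv_kappaSplit_sub_le_one`, `abv_kappaSplit_mul_sub_le`),
  and the field forms **`hout_field_local_split` / `hS_field_local_split` / `hcong_field_local_split`**: `FinKappa`'s
  three κ-level clauses at a split `w` from the LOCAL clauses «on the support SOME torus translate of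
  `(ψ₁(matO γ), ψ₂(matO γ))` is integral / of size `≤ M` / equals `(γ₀_w · k₁, γ₀_w′ · k₂)` with `k_i ≡ 1 mod q⁻¹ ^ N`
  in both components» — no global representative, no torus class number.
Together with `KappaDataFinLocal` (non-split `w`) the finite side of option (i) is local at EVERY finite place. What
stays in words: that the real `K_w` / `K_N(v₁)` at a split `w` ARE the pairs of integral / congruence matrices in
the adapted coordinates of the two components (the dictionary), and the choice of `ψ₁`, `ψ₂`, `abv` above `w`
(restriction = `hw`). Nothing about periods or (N). Pure algebra.
Sorry-free; axioms: propext / Classical.choice / Quot.sound. §8(d): uses an L-value-free non-vanishing device: NO.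
-/

namespace Summit.Ventures.HodgeRepro2.Tier7.Line3.KappaDataFinLocalSplit

open NumberField Matrix Summit.Ventures.HodgeRepro2.T7SupportTwoTorusInvariant
  Summit.Ventures.HodgeRepro2.Tier7.Line3.KappaCongruence

section model

variable {Kw : Type*} [Field Kw] (abv : AbsoluteValue Kw ℝ)

/-- the split-place discriminant of the second basis, `d′_j = ∑ i, d₁ i · f₁ j i · f₂ j i`: the image of
`disc' σ d f j = ∑ i, d i · f j i · σ(f j i)` under the first embedding, `σ` read as the second one -/
def discSplit (d₁ : Fin 2 → Kw) (f₁ f₂ : Fin 2 → Fin 2 → Kw) (j : Fin 2) : Kw :=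
  ∑ i, d₁ i * (f₁ j i * f₂ j i)

/-- the double-coset invariant at a split place, in the two components: `κ = c₁ c₂ / (d₁₀ · d′₀)` with
`c_i = cc d_i f_i g_i 0 0` (the norm `N(c) = c σ(c)` becomes the product of the two components) -/
def kappaSplit (d₁ d₂ : Fin 2 → Kw) (f₁ f₂ : Fin 2 → Fin 2 → Kw) (g₁ g₂ : Matrix (Fin 2) (Fin 2) Kw) : Kw :=
  cc d₁ f₁ g₁ 0 0 * cc d₂ f₂ g₂ 0 0 / (d₁ 0 * discSplit d₁ f₁ f₂ 0)

/-- **the global invariant read at a split place**: for two conjugate embeddings `ψ₂ = ψ₁ ∘ σ`,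
`ψ₁ (κ(γ))` is `kappaSplit` of the two components of the adapted data and of `γ` -/
theorem map_kappa_eq_kappaSplit {E : Type*} [Field E] (σ : E →+* E) (ψ₁ ψ₂ : E →+* Kw)
    (hψ : ∀ x, ψ₂ x = ψ₁ (σ x)) (d : Fin 2 → E) (f : Fin 2 → Fin 2 → E) (γ : Matrix (Fin 2) (Fin 2) E) :
    ψ₁ (kappa σ d f γ) = kappaSplit (fun i => ψ₁ (d i)) (fun i => ψ₂ (d i)) (fun j i => ψ₁ (f j i))
      (fun j i => ψ₂ (f j i)) (γ.map ψ₁) (γ.map ψ₂) := by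
  have h1 : ψ₁ (cc d f γ 0 0) = cc (fun i => ψ₁ (d i)) (fun j i => ψ₁ (f j i)) (γ.map ψ₁) 0 0 := by
    simp only [cc, map_mul, RingHom.map_mulVec, Function.comp_def]
  have h2 : ψ₁ (σ (cc d f γ 0 0)) = cc (fun i => ψ₂ (d i)) (fun j i => ψ₂ (f j i)) (γ.map ψ₂) 0 0 := by
    rw [← hψ]
    simp only [cc, map_mul, RingHom.map_mulVec, Function.comp_def]
  have h3 : ψ₁ (disc' σ d f 0) =
      discSplit (fun i => ψ₁ (d i)) (fun j i => ψ₁ (f j i)) (fun j i => ψ₂ (f j i)) 0 := by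
    simp only [disc', herm, discSplit, map_sum, map_mul, hψ]
  rw [kappa, kappaSplit, nrm, map_div₀, map_mul, map_mul, h1, h2, h3]

/-- **the local torus-translate clause at a split place**: `(m₁, m₂)` is `t_A⁻¹ (g₁, g₂) t_B` in the adapted
coordinates of the two components — `m_i = diagonal a_i · g_i · t_i`, the split norm-one conditions
`a₁ 0 · a₂ 0 = 1`, `b₁ 0 · b₂ 0 = 1`, and `t_i` acting on the second basis `f_i` by `b_i` -/
def IsTranslateSplit (f₁ f₂ : Fin 2 → Fin 2 → Kw) (g₁ g₂ m₁ m₂ : Matrix (Fin 2) (Fin 2) Kw) : Prop :=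
  ∃ (a₁ a₂ b₁ b₂ : Fin 2 → Kw) (t₁ t₂ : Matrix (Fin 2) (Fin 2) Kw), a₁ 0 * a₂ 0 = 1 ∧ b₁ 0 * b₂ 0 = 1 ∧
    ActsOn f₁ t₁ b₁ ∧ ActsOn f₂ t₂ b₂ ∧ m₁ = diagonal a₁ * g₁ * t₁ ∧ m₂ = diagonal a₂ * g₂ * t₂

/-- `kappaSplit` is constant on the split double cosets (p1's `cc_diag_mul` in each component) -/
theorem kappaSplit_diag_mul (d₁ d₂ : Fin 2 → Kw) (f₁ f₂ : Fin 2 → Fin 2 → Kw)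
    (g₁ g₂ t₁ t₂ : Matrix (Fin 2) (Fin 2) Kw) (a₁ a₂ b₁ b₂ : Fin 2 → Kw)
    (ha : a₁ 0 * a₂ 0 = 1) (hb : b₁ 0 * b₂ 0 = 1) (ht₁ : ActsOn f₁ t₁ b₁) (ht₂ : ActsOn f₂ t₂ b₂) :
    kappaSplit d₁ d₂ f₁ f₂ (diagonal a₁ * g₁ * t₁) (diagonal a₂ * g₂ * t₂) =
      kappaSplit d₁ d₂ f₁ f₂ g₁ g₂ := by
  unfold kappaSplit
  rw [cc_diag_mul d₁ f₁ g₁ t₁ a₁ b₁ ht₁, cc_diag_mul d₂ f₂ g₂ t₂ a₂ b₂ ht₂]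
  congr 1
  calc a₁ 0 * b₁ 0 * cc d₁ f₁ g₁ 0 0 * (a₂ 0 * b₂ 0 * cc d₂ f₂ g₂ 0 0)
      = (a₁ 0 * a₂ 0) * (b₁ 0 * b₂ 0) * (cc d₁ f₁ g₁ 0 0 * cc d₂ f₂ g₂ 0 0) := by ring
    _ = cc d₁ f₁ g₁ 0 0 * cc d₂ f₂ g₂ 0 0 := by rw [ha, hb, one_mul, one_mul]

/-- κ is invariant under the local torus translate at a split place -/
theorem kappaSplit_eq_of_isTranslateSplit (d₁ d₂ : Fin 2 → Kw) (f₁ f₂ : Fin 2 → Fin 2 → Kw)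
    {g₁ g₂ m₁ m₂ : Matrix (Fin 2) (Fin 2) Kw} (h : IsTranslateSplit f₁ f₂ g₁ g₂ m₁ m₂) :
    kappaSplit d₁ d₂ f₁ f₂ m₁ m₂ = kappaSplit d₁ d₂ f₁ f₂ g₁ g₂ := by
  obtain ⟨a₁, a₂, b₁, b₂, t₁, t₂, ha, hb, ht₁, ht₂, rfl, rfl⟩ := h
  exact kappaSplit_diag_mul d₁ d₂ f₁ f₂ g₁ g₂ t₁ t₂ a₁ a₂ b₁ b₂ ha hb ht₁ ht₂

/-- **`|κ| ≤ M⁶ / |d₁₀ d′₀|`** at a split place: entries of both components of `γ`, `f 0`, `d 0` of size `≤ M` -/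
theorem abv_kappaSplit_le (hna : IsNonarchimedean abv) (d₁ d₂ : Fin 2 → Kw) (f₁ f₂ : Fin 2 → Fin 2 → Kw)
    (g₁ g₂ : Matrix (Fin 2) (Fin 2) Kw) {M : ℝ} (hM : 0 ≤ M)
    (hg₁ : ∀ i j, abv (g₁ i j) ≤ M) (hg₂ : ∀ i j, abv (g₂ i j) ≤ M)
    (hf₁ : ∀ i, abv (f₁ 0 i) ≤ M) (hf₂ : ∀ i, abv (f₂ 0 i) ≤ M) (hd₁ : abv (d₁ 0) ≤ M)
    (hd₂ : abv (d₂ 0) ≤ M) :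
    abv (kappaSplit d₁ d₂ f₁ f₂ g₁ g₂) ≤ M ^ 6 / abv (d₁ 0 * discSplit d₁ f₁ f₂ 0) := by
  have hc₁ : abv (cc d₁ f₁ g₁ 0 0) ≤ M ^ 3 := abv_cc_le abv hna d₁ f₁ g₁ hM hg₁ hf₁ hd₁
  have hc₂ : abv (cc d₂ f₂ g₂ 0 0) ≤ M ^ 3 := abv_cc_le abv hna d₂ f₂ g₂ hM hg₂ hf₂ hd₂
  have hn : abv (cc d₁ f₁ g₁ 0 0 * cc d₂ f₂ g₂ 0 0) ≤ M ^ 6 := by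
    rw [abv.map_mul, show M ^ 6 = M ^ 3 * M ^ 3 by ring]
    exact mul_le_mul hc₁ hc₂ (abv.nonneg _) (by positivity)
  rw [kappaSplit, map_div₀ abv]
  by_cases hden : abv (d₁ 0 * discSplit d₁ f₁ f₂ 0) = 0
  · rw [hden, div_zero, div_zero]
  · have hpos : 0 < abv (d₁ 0 * discSplit d₁ f₁ f₂ 0) := lt_of_le_of_ne (abv.nonneg _) (Ne.symm hden)
    exact div_le_div_of_nonneg_right hn hpos.le

/-- the integral case at a split place: `|κ| ≤ 1` -/
theorem abv_kappaSplit_le_one (hna : IsNonarchimedean abv) (d₁ d₂ : Fin 2 → Kw) (f₁ f₂ : Fin 2 → Fin 2 → Kw)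
    (g₁ g₂ : Matrix (Fin 2) (Fin 2) Kw)
    (hg₁ : ∀ i j, abv (g₁ i j) ≤ 1) (hg₂ : ∀ i j, abv (g₂ i j) ≤ 1)
    (hf₁ : ∀ i, abv (f₁ 0 i) ≤ 1) (hf₂ : ∀ i, abv (f₂ 0 i) ≤ 1) (hd₁ : abv (d₁ 0) ≤ 1)
    (hd₂ : abv (d₂ 0) ≤ 1) (hdisc : abv (d₁ 0 * discSplit d₁ f₁ f₂ 0) = 1) :
    abv (kappaSplit d₁ d₂ f₁ f₂ g₁ g₂) ≤ 1 := by
  have h := abv_kappaSplit_le abv hna d₁ d₂ f₁ f₂ g₁ g₂ zero_le_one hg₁ hg₂ hf₁ hf₂ hd₁ hd₂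
  rwa [hdisc, one_pow, div_one] at h

/-- **`hout` at a split place, local form**: two integral pairs ⇒ `|κ(γ) − κ(γ₀)| ≤ 1` -/
theorem abv_kappaSplit_sub_le_one (hna : IsNonarchimedean abv) (d₁ d₂ : Fin 2 → Kw)
    (f₁ f₂ : Fin 2 → Fin 2 → Kw) (g₁ g₂ g₁' g₂' : Matrix (Fin 2) (Fin 2) Kw)
    (hg₁ : ∀ i j, abv (g₁ i j) ≤ 1) (hg₂ : ∀ i j, abv (g₂ i j) ≤ 1)
    (hg₁' : ∀ i j, abv (g₁' i j) ≤ 1) (hg₂' : ∀ i j, abv (g₂' i j) ≤ 1)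
    (hf₁ : ∀ i, abv (f₁ 0 i) ≤ 1) (hf₂ : ∀ i, abv (f₂ 0 i) ≤ 1) (hd₁ : abv (d₁ 0) ≤ 1)
    (hd₂ : abv (d₂ 0) ≤ 1) (hdisc : abv (d₁ 0 * discSplit d₁ f₁ f₂ 0) = 1) :
    abv (kappaSplit d₁ d₂ f₁ f₂ g₁ g₂ - kappaSplit d₁ d₂ f₁ f₂ g₁' g₂') ≤ 1 := by
  have h1 := abv_kappaSplit_le_one abv hna d₁ d₂ f₁ f₂ g₁ g₂ hg₁ hg₂ hf₁ hf₂ hd₁ hd₂ hdisc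
  have h2 := abv_kappaSplit_le_one abv hna d₁ d₂ f₁ f₂ g₁' g₂' hg₁' hg₂' hf₁ hf₂ hd₁ hd₂ hdisc
  have h := hna (kappaSplit d₁ d₂ f₁ f₂ g₁ g₂) (-(kappaSplit d₁ d₂ f₁ f₂ g₁' g₂'))
  rw [← sub_eq_add_neg, abv.map_neg] at h
  exact h.trans (max_le h1 h2)

/-- **the local congruence at a split place**: `k₁ ≡ 1 ≡ k₂` to precision `ε ≤ 1`, entries of both components of
`γ₀`, `f 0`, `d 0` of size `≤ M` (`M ≥ 1`): `|κ(γ₀ k) − κ(γ₀)| ≤ M⁶ ε / |d₁₀ d′₀|` -/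
theorem abv_kappaSplit_mul_sub_le (hna : IsNonarchimedean abv) (d₁ d₂ : Fin 2 → Kw)
    (f₁ f₂ : Fin 2 → Fin 2 → Kw) (g₁ g₂ k₁ k₂ : Matrix (Fin 2) (Fin 2) Kw) {ε M : ℝ} (hε : 0 ≤ ε)
    (hε1 : ε ≤ 1) (hM : 1 ≤ M)
    (hk₁ : ∀ i j, abv ((k₁ - 1) i j) ≤ ε) (hk₂ : ∀ i j, abv ((k₂ - 1) i j) ≤ ε)
    (hg₁ : ∀ i j, abv (g₁ i j) ≤ M) (hg₂ : ∀ i j, abv (g₂ i j) ≤ M)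
    (hf₁ : ∀ i, abv (f₁ 0 i) ≤ M) (hf₂ : ∀ i, abv (f₂ 0 i) ≤ M) (hd₁ : abv (d₁ 0) ≤ M)
    (hd₂ : abv (d₂ 0) ≤ M) :
    abv (kappaSplit d₁ d₂ f₁ f₂ (g₁ * k₁) (g₂ * k₂) - kappaSplit d₁ d₂ f₁ f₂ g₁ g₂) ≤
      M ^ 6 * ε / abv (d₁ 0 * discSplit d₁ f₁ f₂ 0) := by
  have hM0 : 0 ≤ M := zero_le_one.trans hM
  set c := cc d₁ f₁ (g₁ * k₁) 0 0 with hc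
  set c₀ := cc d₁ f₁ g₁ 0 0 with hc₀
  set c' := cc d₂ f₂ (g₂ * k₂) 0 0 with hc'
  set c₀' := cc d₂ f₂ g₂ 0 0 with hc₀'
  have hdiff : abv (c - c₀) ≤ M ^ 3 * ε := abv_cc_mul_sub_cc_le abv hna d₁ f₁ g₁ k₁ hε hM0 hk₁ hg₁ hf₁ hd₁
  have hdiff' : abv (c' - c₀') ≤ M ^ 3 * ε :=
    abv_cc_mul_sub_cc_le abv hna d₂ f₂ g₂ k₂ hε hM0 hk₂ hg₂ hf₂ hd₂
  have hc₀le : abv c₀ ≤ M ^ 3 := abv_cc_le abv hna d₁ f₁ g₁ hM0 hg₁ hf₁ hd₁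
  have hc₀le' : abv c₀' ≤ M ^ 3 := abv_cc_le abv hna d₂ f₂ g₂ hM0 hg₂ hf₂ hd₂
  have hcle' : abv c' ≤ M ^ 3 := by
    have : c' = (c' - c₀') + c₀' := by ring
    rw [this]
    refine (hna _ _).trans (max_le ?_ hc₀le')
    refine hdiff'.trans ?_
    have : M ^ 3 * ε ≤ M ^ 3 * 1 := mul_le_mul_of_nonneg_left hε1 (by positivity)
    linarith
  have hnum : abv (c * c' - c₀ * c₀') ≤ M ^ 6 * ε := by
    have e : c * c' - c₀ * c₀' = (c - c₀) * c' + c₀ * (c' - c₀') := by ring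
    rw [e]
    refine (hna _ _).trans (max_le ?_ ?_)
    · calc abv ((c - c₀) * c') = abv (c - c₀) * abv c' := abv.map_mul _ _
        _ ≤ (M ^ 3 * ε) * M ^ 3 := mul_le_mul hdiff hcle' (abv.nonneg _) (by positivity)
        _ = M ^ 6 * ε := by ring
    · calc abv (c₀ * (c' - c₀')) = abv c₀ * abv (c' - c₀') := abv.map_mul _ _
        _ ≤ M ^ 3 * (M ^ 3 * ε) := mul_le_mul hc₀le hdiff' (abv.nonneg _) (by positivity)
        _ = M ^ 6 * ε := by ring
  have hκ : kappaSplit d₁ d₂ f₁ f₂ (g₁ * k₁) (g₂ * k₂) - kappaSplit d₁ d₂ f₁ f₂ g₁ g₂ =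
      (c * c' - c₀ * c₀') / (d₁ 0 * discSplit d₁ f₁ f₂ 0) := by
    simp only [kappaSplit, hc, hc₀, hc', hc₀']
    rw [sub_div]
  rw [hκ, map_div₀ abv]
  by_cases hden : abv (d₁ 0 * discSplit d₁ f₁ f₂ 0) = 0
  · rw [hden, div_zero, div_zero]
  · have hpos : 0 < abv (d₁ 0 * discSplit d₁ f₁ f₂ 0) := lt_of_le_of_ne (abv.nonneg _) (Ne.symm hden)
    exact div_le_div_of_nonneg_right hnum hpos.le

end model

/-! ## The `KappaData` / `FinKappa` field forms at a split place, from the local translate condition -/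

section fields

variable {Kw : Type*} [Field Kw] (abv : AbsoluteValue Kw ℝ) {E K : Type*} [Field E] [Field K] [NumberField K]
  [Algebra K E] (σ : E →+* E) (ψ₁ ψ₂ : E →+* Kw) (d : Fin 2 → E) (f : Fin 2 → Fin 2 → E)
  {Orb : Type*} (matO : Orb → Matrix (Fin 2) (Fin 2) E) (κF : Orb → K) (w : FinitePlace K)
  (arith : ℕ → Orb → Prop) (γ₀ : Orb)

/-- the place of `K` applied to a difference of global invariants, read at the split place in the two components -/
theorem place_sub_eq_abv_split (hψ : ∀ x, ψ₂ x = ψ₁ (σ x))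
    (hw : ∀ x : K, w x = abv (ψ₁ (algebraMap K E x)))
    (hκ : ∀ γ, algebraMap K E (κF γ) = kappa σ d f (matO γ)) (γ γ₀ : Orb) :
    w (κF γ - κF γ₀) =
      abv (kappaSplit (fun i => ψ₁ (d i)) (fun i => ψ₂ (d i)) (fun j i => ψ₁ (f j i)) (fun j i => ψ₂ (f j i))
          ((matO γ).map ψ₁) ((matO γ).map ψ₂) -
        kappaSplit (fun i => ψ₁ (d i)) (fun i => ψ₂ (d i)) (fun j i => ψ₁ (f j i)) (fun j i => ψ₂ (f j i))
          ((matO γ₀).map ψ₁) ((matO γ₀).map ψ₂)) := by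
  rw [hw, map_sub, map_sub, hκ, hκ, map_kappa_eq_kappaSplit σ ψ₁ ψ₂ hψ d f,
    map_kappa_eq_kappaSplit σ ψ₁ ψ₂ hψ d f]

/-- **`hout` from the local translate condition at a split place**: on the support, some torus translate of `γ` is
integral in both components -/
theorem hout_field_local_split (hψ : ∀ x, ψ₂ x = ψ₁ (σ x))
    (hw : ∀ x : K, w x = abv (ψ₁ (algebraMap K E x)))
    (hκ : ∀ γ, algebraMap K E (κF γ) = kappa σ d f (matO γ)) (hna : IsNonarchimedean abv)
    (hf₁ : ∀ i, abv (ψ₁ (f 0 i)) ≤ 1) (hf₂ : ∀ i, abv (ψ₂ (f 0 i)) ≤ 1)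
    (hd₁ : abv (ψ₁ (d 0)) ≤ 1) (hd₂ : abv (ψ₂ (d 0)) ≤ 1)
    (hdisc : abv (ψ₁ (d 0) *
      discSplit (fun i => ψ₁ (d i)) (fun j i => ψ₁ (f j i)) (fun j i => ψ₂ (f j i)) 0) = 1)
    (hγ₀ : ∃ m₁ m₂, IsTranslateSplit (fun j i => ψ₁ (f j i)) (fun j i => ψ₂ (f j i))
      ((matO γ₀).map ψ₁) ((matO γ₀).map ψ₂) m₁ m₂ ∧ (∀ i j, abv (m₁ i j) ≤ 1) ∧ ∀ i j, abv (m₂ i j) ≤ 1)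
    (hsupp : ∀ N γ, arith N γ → ∃ m₁ m₂, IsTranslateSplit (fun j i => ψ₁ (f j i)) (fun j i => ψ₂ (f j i))
      ((matO γ).map ψ₁) ((matO γ).map ψ₂) m₁ m₂ ∧ (∀ i j, abv (m₁ i j) ≤ 1) ∧ ∀ i j, abv (m₂ i j) ≤ 1) :
    ∀ N γ, arith N γ → w (κF γ - κF γ₀) ≤ 1 := by
  intro N γ hγ
  obtain ⟨m₁, m₂, hm, hm₁, hm₂⟩ := hsupp N γ hγ
  obtain ⟨n₁, n₂, hn, hn₁, hn₂⟩ := hγ₀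
  rw [place_sub_eq_abv_split abv σ ψ₁ ψ₂ d f matO κF w hψ hw hκ,
    ← kappaSplit_eq_of_isTranslateSplit (fun i => ψ₁ (d i)) (fun i => ψ₂ (d i)) _ _ hm,
    ← kappaSplit_eq_of_isTranslateSplit (fun i => ψ₁ (d i)) (fun i => ψ₂ (d i)) _ _ hn]
  exact abv_kappaSplit_sub_le_one abv hna _ _ _ _ m₁ m₂ n₁ n₂ hm₁ hm₂ hn₁ hn₂ hf₁ hf₂ hd₁ hd₂ hdisc

/-- **`hS` from the local translate condition at a split place**: on the support, some torus translate of `γ` has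
entries `≤ M` in both components -/
theorem hS_field_local_split (hψ : ∀ x, ψ₂ x = ψ₁ (σ x))
    (hw : ∀ x : K, w x = abv (ψ₁ (algebraMap K E x)))
    (hκ : ∀ γ, algebraMap K E (κF γ) = kappa σ d f (matO γ)) (hna : IsNonarchimedean abv)
    {M : ℝ} (hM : 0 ≤ M) (hf₁ : ∀ i, abv (ψ₁ (f 0 i)) ≤ M) (hf₂ : ∀ i, abv (ψ₂ (f 0 i)) ≤ M)
    (hd₁ : abv (ψ₁ (d 0)) ≤ M) (hd₂ : abv (ψ₂ (d 0)) ≤ M)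
    (hγ₀ : ∃ m₁ m₂, IsTranslateSplit (fun j i => ψ₁ (f j i)) (fun j i => ψ₂ (f j i))
      ((matO γ₀).map ψ₁) ((matO γ₀).map ψ₂) m₁ m₂ ∧ (∀ i j, abv (m₁ i j) ≤ M) ∧ ∀ i j, abv (m₂ i j) ≤ M)
    (hsupp : ∀ N γ, arith N γ → ∃ m₁ m₂, IsTranslateSplit (fun j i => ψ₁ (f j i)) (fun j i => ψ₂ (f j i))
      ((matO γ).map ψ₁) ((matO γ).map ψ₂) m₁ m₂ ∧ (∀ i j, abv (m₁ i j) ≤ M) ∧ ∀ i j, abv (m₂ i j) ≤ M) :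
    ∀ N γ, arith N γ → w (κF γ - κF γ₀) ≤
      M ^ 6 / abv (ψ₁ (d 0) * discSplit (fun i => ψ₁ (d i)) (fun j i => ψ₁ (f j i)) (fun j i => ψ₂ (f j i)) 0) := by
  intro N γ hγ
  obtain ⟨m₁, m₂, hm, hm₁, hm₂⟩ := hsupp N γ hγ
  obtain ⟨n₁, n₂, hn, hn₁, hn₂⟩ := hγ₀
  rw [place_sub_eq_abv_split abv σ ψ₁ ψ₂ d f matO κF w hψ hw hκ,
    ← kappaSplit_eq_of_isTranslateSplit (fun i => ψ₁ (d i)) (fun i => ψ₂ (d i)) _ _ hm,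
    ← kappaSplit_eq_of_isTranslateSplit (fun i => ψ₁ (d i)) (fun i => ψ₂ (d i)) _ _ hn]
  have h1 := abv_kappaSplit_le abv hna (fun i => ψ₁ (d i)) (fun i => ψ₂ (d i)) (fun j i => ψ₁ (f j i))
    (fun j i => ψ₂ (f j i)) m₁ m₂ hM hm₁ hm₂ hf₁ hf₂ hd₁ hd₂
  have h2 := abv_kappaSplit_le abv hna (fun i => ψ₁ (d i)) (fun i => ψ₂ (d i)) (fun j i => ψ₁ (f j i))
    (fun j i => ψ₂ (f j i)) n₁ n₂ hM hn₁ hn₂ hf₁ hf₂ hd₁ hd₂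
  have h := hna (kappaSplit (fun i => ψ₁ (d i)) (fun i => ψ₂ (d i)) (fun j i => ψ₁ (f j i))
    (fun j i => ψ₂ (f j i)) m₁ m₂) (-(kappaSplit (fun i => ψ₁ (d i)) (fun i => ψ₂ (d i))
    (fun j i => ψ₁ (f j i)) (fun j i => ψ₂ (f j i)) n₁ n₂))
  rw [← sub_eq_add_neg, abv.map_neg] at h
  exact h.trans (max_le h1 h2)

/-- **`hcong` from the local translate condition at a split `v₁`**: on the support, some torus translate of `γ` is
`(γ₀_w · k₁, γ₀_w′ · k₂)` with `k₁ ≡ 1 ≡ k₂ mod q⁻¹ ^ N`, for a fixed integral local pair `(γ₀_w, γ₀_w′)`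
representing the distinguished coset -/
theorem hcong_field_local_split (hψ : ∀ x, ψ₂ x = ψ₁ (σ x))
    (hw : ∀ x : K, w x = abv (ψ₁ (algebraMap K E x)))
    (hκ : ∀ γ, algebraMap K E (κF γ) = kappa σ d f (matO γ)) (hna : IsNonarchimedean abv)
    (hf₁ : ∀ i, abv (ψ₁ (f 0 i)) ≤ 1) (hf₂ : ∀ i, abv (ψ₂ (f 0 i)) ≤ 1)
    (hd₁ : abv (ψ₁ (d 0)) ≤ 1) (hd₂ : abv (ψ₂ (d 0)) ≤ 1)
    (hdisc : abv (ψ₁ (d 0) *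
      discSplit (fun i => ψ₁ (d i)) (fun j i => ψ₁ (f j i)) (fun j i => ψ₂ (f j i)) 0) = 1)
    {q : ℝ} (hq : 1 < q) (γ₀w γ₀w' : Matrix (Fin 2) (Fin 2) Kw)
    (hγ₀ : IsTranslateSplit (fun j i => ψ₁ (f j i)) (fun j i => ψ₂ (f j i))
      ((matO γ₀).map ψ₁) ((matO γ₀).map ψ₂) γ₀w γ₀w')
    (hγ₀int : ∀ i j, abv (γ₀w i j) ≤ 1) (hγ₀int' : ∀ i j, abv (γ₀w' i j) ≤ 1)
    (hsupp : ∀ N γ, arith N γ → ∃ k₁ k₂ : Matrix (Fin 2) (Fin 2) Kw,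
      IsTranslateSplit (fun j i => ψ₁ (f j i)) (fun j i => ψ₂ (f j i))
        ((matO γ).map ψ₁) ((matO γ).map ψ₂) (γ₀w * k₁) (γ₀w' * k₂) ∧
      (∀ i j, abv ((k₁ - 1) i j) ≤ q⁻¹ ^ N) ∧ ∀ i j, abv ((k₂ - 1) i j) ≤ q⁻¹ ^ N) :
    ∀ N γ, arith N γ → w (κF γ - κF γ₀) ≤ q⁻¹ ^ N := by
  intro N γ hγ
  obtain ⟨k₁, k₂, hm, hk₁, hk₂⟩ := hsupp N γ hγ
  rw [place_sub_eq_abv_split abv σ ψ₁ ψ₂ d f matO κF w hψ hw hκ,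
    ← kappaSplit_eq_of_isTranslateSplit (fun i => ψ₁ (d i)) (fun i => ψ₂ (d i)) _ _ hm,
    ← kappaSplit_eq_of_isTranslateSplit (fun i => ψ₁ (d i)) (fun i => ψ₂ (d i)) _ _ hγ₀]
  have hε : 0 ≤ q⁻¹ ^ N := by positivity
  have hε1 : q⁻¹ ^ N ≤ 1 := pow_le_one₀ (by positivity) (inv_le_one_of_one_le₀ hq.le)
  have h := abv_kappaSplit_mul_sub_le abv hna (fun i => ψ₁ (d i)) (fun i => ψ₂ (d i))
    (fun j i => ψ₁ (f j i)) (fun j i => ψ₂ (f j i)) γ₀w γ₀w' k₁ k₂ hε hε1 le_rfl hk₁ hk₂ hγ₀int hγ₀int'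
    hf₁ hf₂ hd₁ hd₂
  rwa [hdisc, one_pow, one_mul, div_one] at h

end fields

end Summit.Ventures.HodgeRepro2.Tier7.Line3.KappaDataFinLocalSplit
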